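import Summits.CriticalPhenomena.PercolationContinuityZ3.Theorems.PercNearOneGluingNoHeavyLowerTailOneCutCertAlgebra

/-!
# `NoHeavyLowerTail` (crux stmt-CriticalPhenomena-4575), certificate programme for the one-cut bound at
# `|A| = 5`: the Kronecker (base-`M`) form of the fibre sums and its digit test

Layer 2 of the kernel-checked certificate checker (prim-cert-2).  For INTEGER corner tables the fibre sums
`pcoef A B k` of `…OneCutCertAlgebra` are read off one big integer: with `e3 g = Σ_i g_i 3^i` and
`E3 k = Σ_i k_i 3^i` (a bijection `(Fin m → Fin 3) ≃ Fin (3^m)`, Mathlib's `finFunctionFinEquiv`),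

  `KR A · KR B = Σ_k pcoef A B k · M^{E3 k}`,   `KR T := Σ_g T g · M^{e3 g}`   (`KR_mul_KR`),

because `e3 g + e3 h = E3 (key g h)` digitwise without carries.  Hence the certificate number
`Z = Σ_p KR (Λ p) · KR (T p) − KR C · KR H = Σ_{j < 3^m} c_j M^j` lists the fibre sums `c_j` as its
base-`M` "digits" (possibly negative); after adding the offset `K · Σ_j M^j` (`K = M/2`) every digit is
`c_j + K ∈ [0, M)` provided `|c_j| < K`, and `c_j ≥ 0 ⟺ digit ≥ K`.  This file proves exactly that
(`certCoefZ_nonneg_of_digits`), with a divide-and-conquer digit test `digitsGe` (`digitsGe_spec`) that only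
uses shifts of big naturals, so that `native_decide` evaluates it in time linear in the size of `Z`.
The computable construction of `KR` from an array and the graph tables are in the next layer.

Nothing here mentions percolation; no proposition about the crux is asserted.
-/

namespace Summit.CriticalPhenomena.PercolationContinuityZ3.Theorems.OneCutCert

open Finset
open scoped BigOperators

variable {m : ℕ}

/-! ## Base-3 positions -/

/-- Position of a corner: `Σ_i g_i 3^i`. [this work] -/
def e3 (g : Fin m → Bool) : ℕ := ∑ i, (g i).toNat * 3 ^ (i : ℕ)

/-- Position of a key: `Σ_i k_i 3^i`. [this work] -/
def E3 (k : Fin m → Fin 3) : ℕ := ∑ i, (k i : ℕ) * 3 ^ (i : ℕ)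

/-- Positions add digitwise: `e3 g + e3 h = E3 (key g h)`. [this work] -/
theorem e3_add_e3 (g h : Fin m → Bool) : e3 g + e3 h = E3 (key g h) := by
  unfold e3 E3
  rw [← Finset.sum_add_distrib]
  refine Finset.sum_congr rfl fun i _ => ?_
  rw [show ((key g h i : Fin 3) : ℕ) = (g i).toNat + (h i).toNat from bkey_val (g i) (h i), add_mul]

/-- `E3` is Mathlib's `finFunctionFinEquiv`. [this work] -/
theorem E3_eq (k : Fin m → Fin 3) : E3 k = (finFunctionFinEquiv k : ℕ) := by
  rw [finFunctionFinEquiv_apply]; rfl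

/-- `E3 k < 3^m`. [this work] -/
theorem E3_lt (k : Fin m → Fin 3) : E3 k < 3 ^ m := by
  rw [E3_eq]; exact (finFunctionFinEquiv k).2

/-! ## Kronecker numbers of integer tables -/

/-- The Kronecker number of an integer corner table: `Σ_g T g · M^{e3 g}`. [this work] -/
def KR (M : ℕ) (T : (Fin m → Bool) → ℤ) : ℤ := ∑ g, T g * (M : ℤ) ^ e3 g

/-- **Product of Kronecker numbers = fibre sums in base `M`.** [this work] -/
theorem KR_mul_KR (M : ℕ) (A B : (Fin m → Bool) → ℤ) :
    KR M A * KR M B = ∑ k, pcoef A B k * (M : ℤ) ^ E3 k := by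
  unfold KR
  exact sum_mul_sum_key A B (fun g => (M : ℤ) ^ e3 g) (fun g => (M : ℤ) ^ e3 g)
    (fun k => (M : ℤ) ^ E3 k) (fun g h => by rw [← pow_add, e3_add_e3])

/-- Integer fibre sums of the certificate form. [this work] -/
def certCoefZ {P : Type*} [Fintype P] (Λ T : P → (Fin m → Bool) → ℤ) (C H : (Fin m → Bool) → ℤ)
    (k : Fin m → Fin 3) : ℤ :=
  ∑ p, pcoef (Λ p) (T p) k - pcoef C H k

/-- The certificate number `Z = Σ_p KR Λ_p · KR T_p − KR C · KR H`. [this work] -/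
def certZ {P : Type*} [Fintype P] (M : ℕ) (Λ T : P → (Fin m → Bool) → ℤ)
    (C H : (Fin m → Bool) → ℤ) : ℤ :=
  ∑ p, KR M (Λ p) * KR M (T p) - KR M C * KR M H

/-- `Z = Σ_k c_k M^{E3 k}`. [this work] -/
theorem certZ_eq {P : Type*} [Fintype P] (M : ℕ) (Λ T : P → (Fin m → Bool) → ℤ)
    (C H : (Fin m → Bool) → ℤ) :
    certZ M Λ T C H = ∑ k, certCoefZ Λ T C H k * (M : ℤ) ^ E3 k := by
  unfold certZ certCoefZ
  simp_rw [KR_mul_KR, sub_mul, Finset.sum_mul]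
  rw [Finset.sum_sub_distrib, Finset.sum_comm]

/-- Casting the integer fibre sums gives the real ones. [this work] -/
theorem certCoef_cast {P : Type*} [Fintype P] (Λ T : P → (Fin m → Bool) → ℤ)
    (C H : (Fin m → Bool) → ℤ) (k : Fin m → Fin 3) :
    certCoef (fun p g => (Λ p g : ℝ)) (fun p g => (T p g : ℝ)) (fun g => (C g : ℝ)) (fun g => (H g : ℝ)) k
      = (certCoefZ Λ T C H k : ℝ) := by
  unfold certCoef certCoefZ pcoef
  push_cast
  rfl

/-! ## Base-`M` digits -/

/-- Digit `j` of `n` in base `M`. [folklore] -/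
def digit (M n j : ℕ) : ℕ := n / M ^ j % M

/-- **Digits of a base-`M` expansion** `n = Σ_{j<L} d_j M^j` with `d_j < M`. [folklore] -/
theorem digit_of_sum (M : ℕ) (hM : 0 < M) :
    ∀ (L : ℕ) (d : Fin L → ℕ), (∀ j, d j < M) →
      ∀ j : Fin L, digit M (∑ i : Fin L, d i * M ^ (i : ℕ)) j = d j := by
  intro L
  induction L with
  | zero => intro d _ j; exact j.elim0
  | succ L ih =>
    intro d hd j
    have hsplit : ∑ i : Fin (L + 1), d i * M ^ (i : ℕ) =
        d 0 + M * ∑ i : Fin L, d i.succ * M ^ (i : ℕ) := by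
      rw [Fin.sum_univ_succ, Finset.mul_sum]
      simp only [Fin.val_zero, pow_zero, mul_one, Fin.val_succ, pow_succ]
      congr 1
      exact Finset.sum_congr rfl fun i _ => by ring
    rw [hsplit]
    unfold digit
    refine Fin.cases ?_ (fun j' => ?_) j
    · simp only [Fin.val_zero, pow_zero, Nat.div_one]
      rw [Nat.add_mul_mod_self_left, Nat.mod_eq_of_lt (hd 0)]
    · have := ih (fun i => d i.succ) (fun i => hd i.succ) j'
      unfold digit at this
      rw [Fin.val_succ, pow_succ', ← Nat.div_div_eq_div_mul, Nat.add_mul_div_left _ _ hM,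
        Nat.div_eq_of_lt (hd 0), zero_add]
      exact this

/-! ## The divide-and-conquer digit test (shift-based, for `M = 2^s`) -/

/-- All of the `L` lowest base-`2^s` digits of `n` are `≥ K` (divide and conquer on shifts). [this work] -/
def digitsGe (s K : ℕ) : ℕ → ℕ → Bool
  | n, 0 => decide (n = n)
  | n, 1 => decide (K ≤ n % 2 ^ s)
  | n, L + 2 =>
    let h := (L + 2) / 2
    digitsGe s K (n % 2 ^ (s * h)) h && digitsGe s K (n >>> (s * h)) (L + 2 - h)
termination_by _ L => L
decreasing_by all_goals omega

/-- Digits below a split point are digits of the remainder. [folklore] -/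
theorem digit_mod_pow (M n h j : ℕ) (hM : 0 < M) (hj : j < h) :
    digit M (n % M ^ h) j = digit M n j := by
  unfold digit
  conv_rhs => rw [← Nat.div_add_mod n (M ^ h)]
  have hsplit : M ^ h * (n / M ^ h) = M ^ j * (M ^ (h - j) * (n / M ^ h)) := by
    rw [← mul_assoc, ← pow_add, Nat.add_sub_cancel' hj.le]
  rw [hsplit, Nat.mul_add_div (pow_pos hM j)]
  obtain ⟨d, hd⟩ : ∃ d, h - j = d + 1 := ⟨h - j - 1, by omega⟩
  rw [hd, pow_succ', mul_assoc, Nat.mul_add_mod]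

/-- Digits above a split point are digits of the quotient. [folklore] -/
theorem digit_div_pow (M n h j : ℕ) : digit M (n / M ^ h) j = digit M n (h + j) := by
  unfold digit
  rw [Nat.div_div_eq_div_mul, ← pow_add]

/-- **Soundness of the digit test**: every one of the `L` lowest base-`2^s` digits is `≥ K`. [this work] -/
theorem digitsGe_spec (s K : ℕ) :
    ∀ L n, digitsGe s K n L = true → ∀ j < L, K ≤ digit (2 ^ s) n j := by
  intro L
  induction L using Nat.strong_induction_on with
  | _ L ih =>
    intro n h j hj
    match L, h, hj with
    | 0, _, hj => exact absurd hj (Nat.not_lt_zero _)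
    | 1, h, hj =>
      have hj0 : j = 0 := by omega
      subst hj0
      simp only [digitsGe, decide_eq_true_eq] at h
      simpa [digit] using h
    | L + 2, h, hj =>
      simp only [digitsGe, Bool.and_eq_true] at h
      set hh := (L + 2) / 2 with hhh
      have hpos : 0 < (2 : ℕ) ^ s := pow_pos (by norm_num) s
      by_cases hjh : j < hh
      · have h1 := ih hh (by omega) (n % 2 ^ (s * hh)) h.1 j hjh
        rwa [pow_mul, digit_mod_pow _ _ _ _ hpos hjh] at h1
      · have h2 := ih (L + 2 - hh) (by omega) (n >>> (s * hh)) h.2 (j - hh) (by omega)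
        rwa [Nat.shiftRight_eq_div_pow, pow_mul, digit_div_pow, Nat.add_sub_cancel' (not_lt.1 hjh)]
          at h2

/-! ## From digits to the signs of the fibre sums -/

/-- Reindexing a sum over keys by positions. [this work] -/
theorem sum_keys_eq_sum_fin {R : Type*} [AddCommMonoid R] (f : ℕ → R) :
    ∑ k : Fin m → Fin 3, f (E3 k) = ∑ j : Fin (3 ^ m), f j := by
  simp_rw [E3_eq]
  exact finFunctionFinEquiv.sum_comp (fun j : Fin (3 ^ m) => f j)

/-- A bound on all integer fibre sums. [this work] -/
def CoefBound {P : Type*} [Fintype P] (Λ T : P → (Fin m → Bool) → ℤ) (C H : (Fin m → Bool) → ℤ)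
    (K : ℕ) : Prop :=
  ∀ k, |certCoefZ Λ T C H k| < K

/-- **Digit criterion.** If every fibre sum is `< K = 2^(s-1)` in absolute value, `Z + K·Σ_{j<3^m} (2^s)^j`
equals the natural number `N`, and all `3^m` lowest base-`2^s` digits of `N` are `≥ K`, then every fibre
sum is nonnegative. [this work] -/
theorem certCoefZ_nonneg_of_digits {P : Type*} [Fintype P] {Λ T : P → (Fin m → Bool) → ℤ}
    {C H : (Fin m → Bool) → ℤ} {s : ℕ} (hs : 0 < s) (hB : CoefBound Λ T C H (2 ^ (s - 1)))
    (N : ℕ) (hN : (N : ℤ) = certZ (2 ^ s) Λ T C H + ∑ j : Fin (3 ^ m), (2 : ℤ) ^ (s - 1) * (2 ^ s) ^ (j : ℕ))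
    (hdig : digitsGe s (2 ^ (s - 1)) N (3 ^ m) = true) :
    ∀ k, 0 ≤ certCoefZ Λ T C H k := by
  have hK2 : (2 : ℕ) ^ s = 2 * 2 ^ (s - 1) := by
    rw [← pow_succ']; congr 1; omega
  -- the digits of N
  let d : Fin (3 ^ m) → ℕ := fun j => (certCoefZ Λ T C H (finFunctionFinEquiv.symm j) + 2 ^ (s - 1)).toNat
  have hdnn : ∀ k, 0 ≤ certCoefZ Λ T C H k + 2 ^ (s - 1) := fun k => by
    have := (abs_lt.1 (hB k)).1; push_cast at this ⊢; linarith
  have hK2z : (2 : ℤ) ^ s = 2 * 2 ^ (s - 1) := by exact_mod_cast hK2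
  have hdlt : ∀ j, d j < 2 ^ s := fun j => by
    have h1 := (abs_lt.1 (hB (finFunctionFinEquiv.symm j))).2
    have h2 := hdnn (finFunctionFinEquiv.symm j)
    have h3 : ((d j : ℕ) : ℤ) < (2 : ℤ) ^ s := by
      simp only [d]
      rw [Int.toNat_of_nonneg h2, hK2z]
      push_cast at h1 ⊢
      linarith
    exact_mod_cast h3
  have hNsum : N = ∑ j : Fin (3 ^ m), d j * (2 ^ s) ^ (j : ℕ) := by
    zify
    rw [hN, certZ_eq, ← (Equiv.sum_comp finFunctionFinEquiv.symm
      (fun k => certCoefZ Λ T C H k * ((2 ^ s : ℕ) : ℤ) ^ E3 k)), ← Finset.sum_add_distrib]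
    refine Finset.sum_congr rfl fun j _ => ?_
    have hEj : E3 (finFunctionFinEquiv.symm j) = (j : ℕ) := by
      rw [E3_eq, Equiv.apply_symm_apply]
    rw [hEj]
    simp only [d]
    rw [Int.toNat_of_nonneg (hdnn _)]
    push_cast
    ring
  intro k
  have hj := digitsGe_spec s _ _ _ hdig (finFunctionFinEquiv k) (finFunctionFinEquiv k).2
  rw [hNsum, digit_of_sum _ (pow_pos (by norm_num) s) _ d hdlt] at hj
  -- d (E k) = (c_k + K).toNat ≥ K ⇒ c_k ≥ 0
  have h2 := hdnn k
  simp only [d, Equiv.symm_apply_apply] at hj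
  zify at hj
  rw [Int.toNat_of_nonneg h2] at hj
  linarith

end Summit.CriticalPhenomena.PercolationContinuityZ3.Theorems.OneCutCert
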